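import Literature.MathematicalPhysics.QuantumChemistry.SecondQuantizedHamiltonian
import Mathlib.Analysis.Convex.Slope
import HarnessLib

/-!
# Perturbation and difference bounds for sector ground-state energies (Weyl's sandwich, the
# Lagrangian pencil inequality, Loewner-order bounds, concavity along a coupling)

Topic `MathematicalPhysics/QuantumChemistry`. Elementary, fully PROVED inequalities relating the
lowest energies `minEnergyOn A K`, `minEnergyOn B K` (`Matrix.minEnergyOn`, the bottom of the
Rayleigh quotient on the unit sphere of a subspace `K`) of two Hermitian matrices `A`, `B` on a
COMMON subspace ("sector") `K ≠ ⊥`, specialised at the end to the `(N↑, N↓) = (a, b)` sector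
ground energies `sectorGroundEnergy` of two number- and `Ŝ_z`-conserving operators on one fermionic
Fock space `Fock (Orb Λ)` (two second-quantized Hamiltonians on the same orbital space). They are the
soundness primitives behind certified bounds on a DIFFERENCE `E₀(H_A) − E₀(H_B)` of ground-state
energies (a reaction energy as the difference of two pinned model Hamiltonians in one sector).

## Contents (all proved; no definition, no named fact)
* `le_minEnergyOn_of_forall_re_rayleigh` — a uniform lower bound on the Rayleigh quotients of the
  unit vectors of `K ≠ ⊥` bounds `minEnergyOn` from below.
* `minEnergyOn_real_smul_sub_le` — **the pencil (Lagrangian) inequality**: for `A` Hermitian and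
  `K`-invariant, `B` Hermitian and every REAL `c`,
  `minEnergyOn (c·A − B) K ≤ c · minEnergyOn A K − minEnergyOn B K`
  (a sector ground state of `A` is a trial state for both `c·A − B` and `B`). Read as
  `E_K(A) − E_K(B) ≥ E_K(c·A − B) − (c − 1)·E_K(A)`: any lower bound on the sector energy of the
  COMBINED operator `c·A − B` plus an upper bound on `E_K(A)` (if `c ≥ 1`) or a lower bound on
  `E_K(A)` (if `c ≤ 1`) bounds the difference from below; exchanging `A` and `B` bounds it from
  above. `c − 1 = μ ≥ 0` is the Lagrange multiplier of the energy-window constraint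
  `⟨Γ, A⟩ ≤ U_A` adjoined to "minimise `⟨Γ, A − B⟩` over a convex outer approximation of the state
  space" (weak duality, Boyd–Vandenberghe §5.1.3): the windowed observable bound of Han (2020)
  eq. (ob) / Wang et al. (2024) eq. (obsopt) for the observable `A − B`.
* `minEnergyOn_sub_le_sub`, `sub_le_neg_minEnergyOn_sub` — **Weyl's sandwich** (`c = 1`):
  `λ_min((A − B)|_K) ≤ E_K(A) − E_K(B) ≤ λ_max((A − B)|_K) = −E_K(B − A)`; Horn–Johnson
  Cor. 4.3.15 eq. (4.3.16) with `i = 1` («λ_i(A) + λ_1(B) ≤ λ_i(A + B) ≤ λ_i(A) + λ_n(B)»),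
  restricted to an invariant subspace.
* `le_minEnergyOn_of_posSemidef`, `le_sub_of_posSemidef`, `sub_le_of_posSemidef` — the
  **Loewner-order (operator-norm) form**: `A − B − β·1 ⪰ 0 ⇒ β ≤ E_K(A) − E_K(B)` and
  `α·1 − (A − B) ⪰ 0 ⇒ E_K(A) − E_K(B) ≤ α` (Horn–Johnson Cor. 4.3.12: `B ⪰ 0 ⇒ λ_i(A) ≤ λ_i(A+B)`).
* `minEnergyOn_pencil_slope_anti` — **continuation in a coupling**: along `s ↦ H + sV` the secant
  slopes of `e(s) = E_K(H + sV)` are non-increasing (the tree's `concaveOn_minEnergyOn_pencil`,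
  Griffiths 1966 §II, with Mathlib `ConcaveOn.slope_anti_adjacent`).
* Sector versions on `Fock (Orb Λ)`: `sectorGroundEnergy_real_smul_sub_le`,
  `sectorGroundEnergy_sub_le_sub`, `sub_le_neg_sectorGroundEnergy_sub`,
  `le_sectorGroundEnergy_sub_of_posSemidef`, `sectorGroundEnergy_sub_le_of_posSemidef`,
  `sectorGroundEnergy_pencil_slope_anti`, for operators commuting with `N̂` and `Ŝ_z`
  (e.g. `molecularHamiltonian`, `molecularHamiltonian_commute_totalNumber` / `_spinZ`).

What is NOT here: Temple's inequality (Reed–Simon IV Thm XIII.5), Thirring's and Kato's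
variance-based bounds (named facts to be typed with their locators); the N-representability
relaxation side (the inequalities hold for the EXACT sector energies and are combined with
certified rows in `Summits/Ventures/CertifiedQuantumChemistry/Rows/`); anything about particular
integral files.

## Tree search
REUSED: `Matrix.minEnergyOn`, `minEnergyOn_le_rayleigh_of_mem`, `exists_unit_eigen_minEnergyOn`,
`re_rayleigh_of_eigen_minEnergyOn`, `concaveOn_minEnergyOn_pencil`, `exists_normalize`,
`sectorGroundEnergy`, `mulVec_mem_szSector_of_commute`, `szSector_upDown_ne_bot`; Mathlib
`Matrix.PosSemidef.dotProduct_mulVec_nonneg`, `ConcaveOn.slope_anti_adjacent`. `lean search --decl`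
for `minEnergyOn_(add|sub|smul)|abs_minEnergyOn`: the entrywise-ℓ¹ Lipschitz bound
`abs_minEnergyOn_sub_le` and line-concavity live Summits-side (`Rows/SectorEnergyConcavity`); the
one-`κ` chord inequalities exist in Summits sketch files only; no Literature statement of the
sandwich / pencil / Loewner forms — hence this file.

## References
* R. A. Horn, C. R. Johnson, *Matrix Analysis*, 2nd ed., Cambridge UP (2013), §4.3: Thm 4.3.1
  (Weyl), Cor. 4.3.12, Cor. 4.3.15 eq. (4.3.16). [cite: HornJohnson2013, Cor. 4.3.15 eq. (4.3.16)]
* H. Tasaki, *Physics and Mathematics of Quantum Many-Body Systems*, Springer (2020), §2.1–2.2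
  (variational characterisation of the lowest energy in an invariant subspace). [cite: Tasaki2020, §2.2]
* R. B. Griffiths, Phys. Rev. 152 (1966) 240, §II (concavity of the ground energy in a coupling);
  E. H. Lieb, R. Seiringer, *The Stability of Matter in Quantum Mechanics*, Cambridge UP (2009),
  §3.2.3 proof of Prop. 3.1 («the ground state energy is the infimum over (ψ, Hψ) and hence is
  concave»). [cite: LiebSeiringer2009, §3.2.3 proof of Prop. 3.1]
* S. Boyd, L. Vandenberghe, *Convex Optimization*, Cambridge UP (2004), §5.1.3 (the Lagrange dual
  function bounds the optimal value). [cite: BoydVandenberghe2004, §5.1.3]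
* X. Han, *Quantum many-body bootstrap*, arXiv:2006.06002 (2020), eq. (ob); J. Wang et al.,
  *Certifying ground-state properties of many-body systems*, PRX 14 (2024) 031006, §3 eq. (obsopt)
  (observable bounds given a certified energy window).
-/

noncomputable section

namespace Literature.MathematicalPhysics.QuantumChemistry

open Matrix
open Literature.MathematicalPhysics.QuantumLattice
open scoped ComplexOrder

/-! ### Two Hermitian matrices on a common subspace -/

section Generic

variable {n : Type*} [Fintype n] [DecidableEq n]

omit [Fintype n] [DecidableEq n] in
/-- A real pencil of Hermitian matrices is Hermitian: `(c·A − B)ᴴ = c·A − B` for real `c`.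
Horn–Johnson (2013) §4.3 (the setting of Weyl's theorem: sums of Hermitian matrices). [folklore] -/
private theorem isHermitian_real_smul_sub {A B : Matrix n n ℂ} (hA : A.IsHermitian) (hB : B.IsHermitian)
    (c : ℝ) : ((c : ℂ) • A - B).IsHermitian := by
  have hcA : ((c : ℂ) • A).IsHermitian := by
    rw [IsHermitian, conjTranspose_smul, hA.eq, Complex.star_def, Complex.conj_ofReal]
  exact hcA.sub hB

omit [DecidableEq n] in
/-- The Rayleigh quotient is affine along a real pencil:
`Re⟨ψ, (c·A − B)ψ⟩ = c·Re⟨ψ, Aψ⟩ − Re⟨ψ, Bψ⟩`. [folklore] -/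
private theorem re_rayleigh_real_smul_sub (A B : Matrix n n ℂ) (c : ℝ) (ψ : n → ℂ) :
    (star ψ ⬝ᵥ ((c : ℂ) • A - B) *ᵥ ψ).re =
      c * (star ψ ⬝ᵥ A *ᵥ ψ).re - (star ψ ⬝ᵥ B *ᵥ ψ).re := by
  rw [sub_mulVec, smul_mulVec, dotProduct_sub, dotProduct_smul, Complex.sub_re, smul_eq_mul,
    Complex.re_ofReal_mul]

omit [DecidableEq n] in
/-- **Uniform Rayleigh lower bounds pass to the sector energy.** If `K ≠ ⊥` and every unit vector
`ψ ∈ K` has `e ≤ Re⟨ψ, Mψ⟩`, then `e ≤ minEnergyOn M K` (the infimum of a non-empty set bounded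
below by `e`): the variational characterisation of the lowest energy in an invariant subspace,
Tasaki (2020) §2.2 (here for an arbitrary subspace, as a property of the infimum).
[cite: Tasaki2020, §2.2] -/
theorem le_minEnergyOn_of_forall_re_rayleigh (M : Matrix n n ℂ) {K : Submodule ℂ (n → ℂ)}
    (hK : K ≠ ⊥) {e : ℝ} (h : ∀ ψ ∈ K, star ψ ⬝ᵥ ψ = 1 → e ≤ (star ψ ⬝ᵥ M *ᵥ ψ).re) :
    e ≤ M.minEnergyOn K := by
  obtain ⟨w, hwK, hw0⟩ := Submodule.exists_mem_ne_zero_of_ne_bot hK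
  obtain ⟨c, -, -, hc1⟩ := EigenvalueContinuation.exists_normalize hw0
  unfold Matrix.minEnergyOn
  refine le_csInf ⟨_, (c : ℂ) • w, K.smul_mem _ hwK, hc1, rfl⟩ ?_
  rintro E ⟨ψ, hψK, hψ1, rfl⟩
  exact h ψ hψK hψ1

/-- **The pencil (Lagrangian) inequality.** For Hermitian `A`, `B`, a subspace `K ≠ ⊥` invariant
under `A`, and every real `c`:
`minEnergyOn (c·A − B) K ≤ c · minEnergyOn A K − minEnergyOn B K`.
Proof: a unit sector ground EIGENvector `ψ` of `A` (`Aψ = E_K(A)ψ`, it exists since `K` is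
`A`-invariant) is a trial state for `c·A − B`, giving `E_K(c·A − B) ≤ c·E_K(A) − Re⟨ψ, Bψ⟩`, and for
`B`, giving `E_K(B) ≤ Re⟨ψ, Bψ⟩`. Equivalently `E_K(A) − E_K(B) ≥ E_K(c·A − B) − (c − 1)·E_K(A)`:
with `c = 1 + μ`, `μ ≥ 0`, this is weak duality for "minimise `⟨Γ, A − B⟩` subject to
`⟨Γ, A⟩ ≤ E_K(A)`" (Boyd–Vandenberghe §5.1.3), the energy-window observable bound of Han (2020)
eq. (ob) for the observable `A − B`; `c = 1` is Weyl's inequality. AS A PRINTED STATEMENT this is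
Horn–Johnson Cor. 4.3.15, lower inequality of (4.3.16) «λ_i(A) + λ_1(B) ≤ λ_i(A + B)» at `i = 1` for
the pair `(B, c·A − B)` together with `λ_1(c·A) ≤ c·λ_1(A)` (equality for `c ≥ 0`), restricted to a
subspace; delta: stated only for `A`-invariant `K` (what the eigenvector proof uses).
[cite: HornJohnson2013, Cor. 4.3.15 eq. (4.3.16)] -/
theorem minEnergyOn_real_smul_sub_le {A B : Matrix n n ℂ} (hA : A.IsHermitian)
    (hB : B.IsHermitian) {K : Submodule ℂ (n → ℂ)} (hKA : ∀ v ∈ K, A *ᵥ v ∈ K) (hK : K ≠ ⊥)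
    (c : ℝ) : ((c : ℂ) • A - B).minEnergyOn K ≤ c * A.minEnergyOn K - B.minEnergyOn K := by
  obtain ⟨ψ, hψK, hψ1, hAψ⟩ := exists_unit_eigen_minEnergyOn hA K hKA hK
  have h1 := minEnergyOn_le_rayleigh_of_mem (isHermitian_real_smul_sub hA hB c) K hψK hψ1
  have h2 := minEnergyOn_le_rayleigh_of_mem hB K hψK hψ1
  rw [re_rayleigh_real_smul_sub, re_rayleigh_of_eigen_minEnergyOn A K hψ1 hAψ] at h1
  linarith

/-- **Weyl's inequality in a sector, lower half**: for Hermitian `A`, `B` and an `A`-invariant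
subspace `K ≠ ⊥`, `minEnergyOn (A − B) K ≤ minEnergyOn A K − minEnergyOn B K`, i.e.
`E_K(B) + λ_min((A − B)|_K) ≤ E_K(A)` — Horn–Johnson Cor. 4.3.15, lower inequality of (4.3.16) with
`i = 1` («λ_i(A) + λ_1(B) ≤ λ_i(A + B)», here with `A ↦ B`, `B ↦ A − B`), restricted to `K`.
[cite: HornJohnson2013, Cor. 4.3.15 eq. (4.3.16)] -/
theorem minEnergyOn_sub_le_sub {A B : Matrix n n ℂ} (hA : A.IsHermitian) (hB : B.IsHermitian)
    {K : Submodule ℂ (n → ℂ)} (hKA : ∀ v ∈ K, A *ᵥ v ∈ K) (hK : K ≠ ⊥) :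
    (A - B).minEnergyOn K ≤ A.minEnergyOn K - B.minEnergyOn K := by
  have h := minEnergyOn_real_smul_sub_le hA hB hKA hK 1
  rwa [Complex.ofReal_one, one_smul, one_mul] at h

/-- **Weyl's inequality in a sector, upper half**: for Hermitian `A`, `B` and a `B`-invariant
subspace `K ≠ ⊥`, `minEnergyOn A K − minEnergyOn B K ≤ −minEnergyOn (B − A) K`, i.e.
`E_K(A) ≤ E_K(B) + λ_max((A − B)|_K)` (`λ_max(V|_K) = −λ_min(−V|_K)`) — Horn–Johnson Cor. 4.3.15,
upper inequality of (4.3.16) with `i = 1`, restricted to `K`.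
[cite: HornJohnson2013, Cor. 4.3.15 eq. (4.3.16)] -/
theorem sub_le_neg_minEnergyOn_sub {A B : Matrix n n ℂ} (hA : A.IsHermitian) (hB : B.IsHermitian)
    {K : Submodule ℂ (n → ℂ)} (hKB : ∀ v ∈ K, B *ᵥ v ∈ K) (hK : K ≠ ⊥) :
    A.minEnergyOn K - B.minEnergyOn K ≤ -(B - A).minEnergyOn K := by
  have h := minEnergyOn_sub_le_sub hB hA hKB hK
  linarith

/-- **A Loewner lower bound passes to every sector**: if `M − β·1 ⪰ 0` then `β ≤ minEnergyOn M K`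
for every `K ≠ ⊥` (each unit vector has `Re⟨ψ, Mψ⟩ ≥ β`). Horn–Johnson Cor. 4.3.12 (monotonicity
of eigenvalues under a positive semidefinite perturbation), restricted to `K`.
[cite: HornJohnson2013, Cor. 4.3.12] -/
theorem le_minEnergyOn_of_posSemidef {M : Matrix n n ℂ} {β : ℝ}
    (hM : (M - (β : ℂ) • (1 : Matrix n n ℂ)).PosSemidef) {K : Submodule ℂ (n → ℂ)} (hK : K ≠ ⊥) :
    β ≤ M.minEnergyOn K := by
  refine le_minEnergyOn_of_forall_re_rayleigh M hK fun ψ _ hψ1 => ?_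
  have h := hM.dotProduct_mulVec_nonneg ψ
  rw [sub_mulVec, smul_mulVec, one_mulVec, dotProduct_sub, dotProduct_smul, hψ1, smul_eq_mul,
    mul_one] at h
  have h' := (Complex.nonneg_iff.mp h).1
  rw [Complex.sub_re, Complex.ofReal_re] at h'
  linarith

/-- **Loewner bound on `A − B`, lower side**: for Hermitian `A`, `B`, an `A`-invariant `K ≠ ⊥` and
`A − B − β·1 ⪰ 0`, `β ≤ minEnergyOn A K − minEnergyOn B K` (operator-norm form: `|β| ≤ ‖A − B‖`
always works with `β = −‖A − B‖`). Horn–Johnson Cor. 4.3.12 / (4.3.16). [cite: HornJohnson2013, Cor. 4.3.12] -/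
theorem le_sub_of_posSemidef {A B : Matrix n n ℂ} (hA : A.IsHermitian)
    (hB : B.IsHermitian) {K : Submodule ℂ (n → ℂ)} (hKA : ∀ v ∈ K, A *ᵥ v ∈ K) (hK : K ≠ ⊥)
    {β : ℝ} (hβ : (A - B - (β : ℂ) • (1 : Matrix n n ℂ)).PosSemidef) :
    β ≤ A.minEnergyOn K - B.minEnergyOn K :=
  (le_minEnergyOn_of_posSemidef hβ hK).trans (minEnergyOn_sub_le_sub hA hB hKA hK)

/-- **Loewner bound on `A − B`, upper side**: for Hermitian `A`, `B`, a `B`-invariant `K ≠ ⊥` and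
`α·1 − (A − B) ⪰ 0`, `minEnergyOn A K − minEnergyOn B K ≤ α`. Horn–Johnson Cor. 4.3.12 / (4.3.16).
[cite: HornJohnson2013, Cor. 4.3.12] -/
theorem sub_le_of_posSemidef {A B : Matrix n n ℂ} (hA : A.IsHermitian)
    (hB : B.IsHermitian) {K : Submodule ℂ (n → ℂ)} (hKB : ∀ v ∈ K, B *ᵥ v ∈ K) (hK : K ≠ ⊥)
    {α : ℝ} (hα : ((α : ℂ) • (1 : Matrix n n ℂ) - (A - B)).PosSemidef) :
    A.minEnergyOn K - B.minEnergyOn K ≤ α := by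
  have h1 : (B - A - ((-α : ℝ) : ℂ) • (1 : Matrix n n ℂ)).PosSemidef := by
    have e : B - A - ((-α : ℝ) : ℂ) • (1 : Matrix n n ℂ) = (α : ℂ) • (1 : Matrix n n ℂ) - (A - B) := by
      rw [Complex.ofReal_neg, neg_smul, sub_neg_eq_add]
      abel
    rw [e]
    exact hα
  have h2 := le_minEnergyOn_of_posSemidef h1 hK
  have h3 := sub_le_neg_minEnergyOn_sub hA hB hKB hK
  linarith

/-- **Secant slopes of the sector energy along a pencil are non-increasing** (concavity in the
coupling). For Hermitian `H`, `V`, a subspace `K ≠ ⊥` and couplings `s₀ < s₁ < s₂`, with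
`e(s) = minEnergyOn (H + sV) K`: `(e(s₂) − e(s₁))/(s₂ − s₁) ≤ (e(s₁) − e(s₀))/(s₁ − s₀)` — so a
difference `e(1) − e(0)` along `H_B + s(H_A − H_B)` is bracketed segment by segment by the endpoint
slopes (the tree's `concaveOn_minEnergyOn_pencil`, Griffiths, Phys. Rev. 152 (1966) 240 §II, with
Mathlib `ConcaveOn.slope_anti_adjacent`). Printed source of the concavity: Lieb–Seiringer (2009)
§3.2.3, proof of Prop. 3.1 (p. 55): «Its ground state energy is the infimum over (ψ, H ψ) and hence
is concave» in a parameter entering the Hamiltonian affinely; delta: the secant-slope form of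
concavity, on a subspace. [cite: LiebSeiringer2009, §3.2.3 proof of Prop. 3.1] -/
theorem minEnergyOn_pencil_slope_anti {H V : Matrix n n ℂ} (hH : H.IsHermitian)
    (hV : V.IsHermitian) {K : Submodule ℂ (n → ℂ)} (hK : K ≠ ⊥) {s₀ s₁ s₂ : ℝ} (h₀₁ : s₀ < s₁)
    (h₁₂ : s₁ < s₂) :
    ((H + (s₂ : ℂ) • V).minEnergyOn K - (H + (s₁ : ℂ) • V).minEnergyOn K) / (s₂ - s₁) ≤
      ((H + (s₁ : ℂ) • V).minEnergyOn K - (H + (s₀ : ℂ) • V).minEnergyOn K) / (s₁ - s₀) :=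
  (concaveOn_minEnergyOn_pencil hH hV hK).slope_anti_adjacent (Set.mem_univ _) (Set.mem_univ _)
    h₀₁ h₁₂

end Generic

/-! ### The `(N↑, N↓) = (a, b)` sector of two operators on one fermionic Fock space -/

section Sector

variable {Λ : Type*} [LinearOrder Λ] [Fintype Λ]

/-- **The pencil (Lagrangian) inequality for sector ground energies.** For Hermitian `H₁`, `H₂` on
`Fock (Orb Λ)` with `H₁` commuting with `N̂` and `Ŝ_z` (e.g. two molecular Hamiltonians on the same
orbital space), `a, b ≤ |Λ|` and every real `c`:
`E₀(c·H₁ − H₂; a, b) ≤ c·E₀(H₁; a, b) − E₀(H₂; a, b)`. The reading for difference certificates: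
`E₀(H₁) − E₀(H₂) ≥ E₀(c·H₁ − H₂) − (c − 1)·E₀(H₁)` in the sector, for every real `c`. Printed
statement: Horn–Johnson (4.3.16) lower inequality at `i = 1` (see `minEnergyOn_real_smul_sub_le`).
[cite: HornJohnson2013, Cor. 4.3.15 eq. (4.3.16)] -/
theorem sectorGroundEnergy_real_smul_sub_le {H₁ H₂ : Matrix (Finset (Orb Λ)) (Finset (Orb Λ)) ℂ}
    (h₁ : H₁.IsHermitian) (h₂ : H₂.IsHermitian) (hN : Commute H₁ totalNumber)
    (hS : Commute H₁ HubbardWave0.spinZ) {a b : ℕ} (ha : a ≤ Fintype.card Λ)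
    (hb : b ≤ Fintype.card Λ) (c : ℝ) :
    sectorGroundEnergy ((c : ℂ) • H₁ - H₂) a b ≤
      c * sectorGroundEnergy H₁ a b - sectorGroundEnergy H₂ a b :=
  minEnergyOn_real_smul_sub_le h₁ h₂ (fun _ hv => mulVec_mem_szSector_of_commute hN hS hv)
    (szSector_upDown_ne_bot ha hb) c

/-- **Weyl's sandwich for sector ground energies, lower half**: `E₀(H₁ − H₂; a, b) ≤
E₀(H₁; a, b) − E₀(H₂; a, b)` (`H₁` Hermitian and `N̂`, `Ŝ_z`-conserving, `H₂` Hermitian,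
`a, b ≤ |Λ|`). Horn–Johnson (4.3.16), `i = 1`, in the sector. [cite: HornJohnson2013, Cor. 4.3.15 eq. (4.3.16)] -/
theorem sectorGroundEnergy_sub_le_sub {H₁ H₂ : Matrix (Finset (Orb Λ)) (Finset (Orb Λ)) ℂ}
    (h₁ : H₁.IsHermitian) (h₂ : H₂.IsHermitian) (hN : Commute H₁ totalNumber)
    (hS : Commute H₁ HubbardWave0.spinZ) {a b : ℕ} (ha : a ≤ Fintype.card Λ)
    (hb : b ≤ Fintype.card Λ) :
    sectorGroundEnergy (H₁ - H₂) a b ≤ sectorGroundEnergy H₁ a b - sectorGroundEnergy H₂ a b :=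
  minEnergyOn_sub_le_sub h₁ h₂ (fun _ hv => mulVec_mem_szSector_of_commute hN hS hv)
    (szSector_upDown_ne_bot ha hb)

/-- **Weyl's sandwich for sector ground energies, upper half**: `E₀(H₁; a, b) − E₀(H₂; a, b) ≤
−E₀(H₂ − H₁; a, b)` (`H₂` Hermitian and `N̂`, `Ŝ_z`-conserving, `H₁` Hermitian, `a, b ≤ |Λ|`).
Horn–Johnson (4.3.16), `i = 1`, in the sector. [cite: HornJohnson2013, Cor. 4.3.15 eq. (4.3.16)] -/
theorem sub_le_neg_sectorGroundEnergy_sub {H₁ H₂ : Matrix (Finset (Orb Λ)) (Finset (Orb Λ)) ℂ}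
    (h₁ : H₁.IsHermitian) (h₂ : H₂.IsHermitian) (hN : Commute H₂ totalNumber)
    (hS : Commute H₂ HubbardWave0.spinZ) {a b : ℕ} (ha : a ≤ Fintype.card Λ)
    (hb : b ≤ Fintype.card Λ) :
    sectorGroundEnergy H₁ a b - sectorGroundEnergy H₂ a b ≤ -sectorGroundEnergy (H₂ - H₁) a b :=
  sub_le_neg_minEnergyOn_sub h₁ h₂ (fun _ hv => mulVec_mem_szSector_of_commute hN hS hv)
    (szSector_upDown_ne_bot ha hb)

/-- **Loewner bound on `H₁ − H₂`, lower side, in a sector**: `H₁ − H₂ − β·1 ⪰ 0` on the Fock space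
gives `β ≤ E₀(H₁; a, b) − E₀(H₂; a, b)`. Horn–Johnson Cor. 4.3.12 in the sector.
[cite: HornJohnson2013, Cor. 4.3.12] -/
theorem le_sectorGroundEnergy_sub_of_posSemidef
    {H₁ H₂ : Matrix (Finset (Orb Λ)) (Finset (Orb Λ)) ℂ} (h₁ : H₁.IsHermitian)
    (h₂ : H₂.IsHermitian) (hN : Commute H₁ totalNumber) (hS : Commute H₁ HubbardWave0.spinZ)
    {a b : ℕ} (ha : a ≤ Fintype.card Λ) (hb : b ≤ Fintype.card Λ) {β : ℝ}
    (hβ : (H₁ - H₂ - (β : ℂ) • (1 : Matrix (Finset (Orb Λ)) (Finset (Orb Λ)) ℂ)).PosSemidef) :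
    β ≤ sectorGroundEnergy H₁ a b - sectorGroundEnergy H₂ a b :=
  le_sub_of_posSemidef h₁ h₂ (fun _ hv => mulVec_mem_szSector_of_commute hN hS hv)
    (szSector_upDown_ne_bot ha hb) hβ

/-- **Loewner bound on `H₁ − H₂`, upper side, in a sector**: `α·1 − (H₁ − H₂) ⪰ 0` gives
`E₀(H₁; a, b) − E₀(H₂; a, b) ≤ α`. Horn–Johnson Cor. 4.3.12 in the sector.
[cite: HornJohnson2013, Cor. 4.3.12] -/
theorem sectorGroundEnergy_sub_le_of_posSemidef
    {H₁ H₂ : Matrix (Finset (Orb Λ)) (Finset (Orb Λ)) ℂ} (h₁ : H₁.IsHermitian)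
    (h₂ : H₂.IsHermitian) (hN : Commute H₂ totalNumber) (hS : Commute H₂ HubbardWave0.spinZ)
    {a b : ℕ} (ha : a ≤ Fintype.card Λ) (hb : b ≤ Fintype.card Λ) {α : ℝ}
    (hα : ((α : ℂ) • (1 : Matrix (Finset (Orb Λ)) (Finset (Orb Λ)) ℂ) - (H₁ - H₂)).PosSemidef) :
    sectorGroundEnergy H₁ a b - sectorGroundEnergy H₂ a b ≤ α :=
  sub_le_of_posSemidef h₁ h₂ (fun _ hv => mulVec_mem_szSector_of_commute hN hS hv)
    (szSector_upDown_ne_bot ha hb) hα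

/-- **Secant slopes of the sector ground energy along `H + sV` are non-increasing** (`H`, `V`
Hermitian, `a, b ≤ |Λ|`, `s₀ < s₁ < s₂`): the continuation primitive for a difference
`E₀(H + V) − E₀(H)` read along the coupling `s ∈ [0, 1]` (Griffiths 1966 §II; the tree's
`concaveOn_minEnergyOn_pencil`; printed concavity statement Lieb–Seiringer (2009) §3.2.3 proof of
Prop. 3.1). [cite: LiebSeiringer2009, §3.2.3 proof of Prop. 3.1] -/
theorem sectorGroundEnergy_pencil_slope_anti {H V : Matrix (Finset (Orb Λ)) (Finset (Orb Λ)) ℂ}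
    (hH : H.IsHermitian) (hV : V.IsHermitian) {a b : ℕ} (ha : a ≤ Fintype.card Λ)
    (hb : b ≤ Fintype.card Λ) {s₀ s₁ s₂ : ℝ} (h₀₁ : s₀ < s₁) (h₁₂ : s₁ < s₂) :
    (sectorGroundEnergy (H + (s₂ : ℂ) • V) a b - sectorGroundEnergy (H + (s₁ : ℂ) • V) a b) /
        (s₂ - s₁) ≤
      (sectorGroundEnergy (H + (s₁ : ℂ) • V) a b - sectorGroundEnergy (H + (s₀ : ℂ) • V) a b) /
        (s₁ - s₀) :=
  minEnergyOn_pencil_slope_anti hH hV (szSector_upDown_ne_bot ha hb) h₀₁ h₁₂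

end Sector

end Literature.MathematicalPhysics.QuantumChemistry

end
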